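import Summits.PneNP.PneNP.Theses.Mobius
import Summits.QuantumAdvantage.QuantumAdvantage.Theorems.MobiusLadderLiouvilleNotAC0
import Summits.QuantumAdvantage.QuantumAdvantage.Theorems.MobiusLadderLiouvilleOrthogonalAC0
import Literature.Computability.Complexity.ACRealize
import Literature.Computability.Complexity.StackWords

/-!
# Route Mobius — `LiouvilleNotAC0` (stmt-PneNP-1112)

Green's theorem for the Liouville language in Mathlib's binary encoding: `bin {N : λ(N) = 1} ∉ AC⁰`. The companion
language `bin {N : λ(N) = -1}` is kernel-checked to lie outside `AC⁰` in the QuantumAdvantage MobiusLadder development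
(`LiouvilleNotAC0_proof` fed with the proved `LiouvilleOrthogonalAC0_proof`); we transfer along the sign: a constant-depth
polynomial-size family for `{λ = 1}` becomes one for `{λ = -1}` by one free negation and one conjunction with the top
input bit (at length `k+1` the codewords are exactly the strings with top bit `1`, i.e. the numerals of `N ≥ 2^k ≥ 1`,
where `λ(N) ∈ {±1}`), in the gate-list calculus `ACReal` (depth `d+1`, size `p(n)+2`).
-/

set_option linter.dupNamespace false -- `Summit.PneNP.PneNP.…`: summit = sub-problem name (D-0017 single-conjunct layout)

namespace Summit.PneNP.PneNP.Theorems

open _root_.Computability Polynomial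
open Literature.Computability.Complexity
open Summit.QuantumAdvantage.QuantumAdvantage.Theorems.MobiusLadder
  (ofFn_testBit_mem_toLanguage_iff testBit_eq_true_of_two_pow_le liouville_eq_one_or_eq_neg_one)

/-- **Sign transfer inside `AC⁰`**: if `bin {N : λ(N) = 1} ∈ AC⁰` then `bin {N : λ(N) = -1} ∈ AC⁰` (negate the output and
conjoin with the top input bit; at length `0` the constant `0`). [cite: AroraBarak2009, §14.1] [folklore] -/
theorem mobius_liouvilleNeg_mem_AC0_of_pos
    (h : encodingNatBool.toLanguage {N : ℕ | ArithmeticFunction.liouville N = 1} ∈ AC0) :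
    encodingNatBool.toLanguage {N : ℕ | ArithmeticFunction.liouville N = -1} ∈ AC0 := by
  obtain ⟨d, p, C, hC, hdec⟩ := h
  set L₁ : Language Bool := encodingNatBool.toLanguage {N : ℕ | ArithmeticFunction.liouville N = 1} with hL₁
  set L₂ : Language Bool := encodingNatBool.toLanguage {N : ℕ | ArithmeticFunction.liouville N = -1} with hL₂
  -- the target Boolean function at each length
  have key : ∀ (k : ℕ) (u : Fin (k + 1) → Bool),
      L₂.boolIndicator (List.ofFn u) = (!(L₁.boolIndicator (List.ofFn u)) && u (Fin.last k)) := by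
    intro k u
    set N := bitsToNat (List.ofFn u) with hN
    have hNlt : N < 2 ^ (k + 1) := by
      have := bitsToNat_lt (List.ofFn u)
      rwa [List.length_ofFn] at this
    have hu : u = fun i : Fin (k + 1) => N.testBit i := by
      funext i
      rw [hN, testBit_bitsToNat_eq_getD, List.getD_eq_getElem?_getD, List.getElem?_ofFn]
      simp [i.isLt]
    have h1 : List.ofFn u ∈ L₁ ↔ 2 ^ k ≤ N ∧ ArithmeticFunction.liouville N = 1 := by
      rw [hu]; exact ofFn_testBit_mem_toLanguage_iff _ hNlt
    have h2 : List.ofFn u ∈ L₂ ↔ 2 ^ k ≤ N ∧ ArithmeticFunction.liouville N = -1 := by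
      rw [hu]; exact ofFn_testBit_mem_toLanguage_iff _ hNlt
    have htop : u (Fin.last k) = true ↔ 2 ^ k ≤ N := by
      rw [hu]
      exact ⟨fun h => Nat.ge_two_pow_of_testBit h, fun h => testBit_eq_true_of_two_pow_le h hNlt⟩
    rw [Bool.eq_iff_iff, Bool.and_eq_true, Bool.not_eq_true', ← Bool.not_eq_true, htop]
    rw [show (L₂.boolIndicator (List.ofFn u) = true) = (List.ofFn u ∈ L₂) from
        propext (Set.mem_iff_boolIndicator _ _).symm,
      show (L₁.boolIndicator (List.ofFn u) = true) = (List.ofFn u ∈ L₁) from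
        propext (Set.mem_iff_boolIndicator _ _).symm, h1, h2]
    constructor
    · rintro ⟨hk, hl⟩
      exact ⟨fun ⟨_, hl'⟩ => by rw [hl'] at hl; norm_num at hl, hk⟩
    · rintro ⟨hnot, hk⟩
      refine ⟨hk, ?_⟩
      have hN0 : N ≠ 0 := by
        have : 0 < 2 ^ k := Nat.two_pow_pos k
        omega
      rcases liouville_eq_one_or_eq_neg_one hN0 with hl | hl
      · exact absurd ⟨hk, hl⟩ hnot
      · exact hl
  -- the new family
  have main : ∀ n : ℕ, ∃ D : Circuit (Fin n), D.IsOver acBasis ∧ D.acDepth ≤ d + 1 ∧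
      D.size ≤ (p + Polynomial.C 2).eval n ∧ ∀ u : Fin n → Bool, D.eval u = L₂.boolIndicator (List.ofFn u) := by
    intro n
    cases n with
    | zero =>
      obtain ⟨D, hDB, hDd, hDs, hDe⟩ := (acReal_const (ι := Fin 0) false).toCircuit
      refine ⟨D, hDB, hDd.trans (by omega), hDs.trans (by simp), fun u => ?_⟩
      rw [hDe]
      symm
      rw [← Bool.not_eq_true, show (L₂.boolIndicator (List.ofFn u) = true) = (List.ofFn u ∈ L₂) from
        propext (Set.mem_iff_boolIndicator _ _).symm]
      rintro ⟨M, hM, hMu⟩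
      have hM0 : M = 0 := by
        have h0 : bitsToNat (encodeNat M) = bitsToNat ([] : List Bool) := by
          rw [show (encodeNat M : List Bool) = List.ofFn u from hMu, List.ofFn_zero]
        simpa using h0
      subst hM0
      simp at hM
    | succ k =>
      have h0 : ACReal (fun u : Fin (k + 1) → Bool => !(C (k + 1)).eval u) d (p.eval (k + 1) + 1) :=
        (ACReal.of_circuit (C (k + 1)) (hC (k + 1)).1 (hC (k + 1)).2.1 (hC (k + 1)).2.2).neg
      have h1 : ACReal (fun u : Fin (k + 1) → Bool => u (Fin.last k)) d 0 :=
        (acReal_input (Fin.last k)).mono (Nat.zero_le _) le_rfl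
      have hall := acReal_forall (M := 2) (f := ![fun u => !(C (k + 1)).eval u, fun u => u (Fin.last k)])
        (d := d) (s := ![p.eval (k + 1) + 1, 0]) (fun j => by fin_cases j <;> simpa)
      obtain ⟨D, hDB, hDd, hDs, hDe⟩ := hall.toCircuit
      refine ⟨D, hDB, hDd, hDs.trans (by simp [Fin.sum_univ_two]), fun u => ?_⟩
      rw [hDe, key k u]
      simp [Fin.forall_fin_two, hdec.eval_eq u]
  choose D hD using main
  refine ⟨d + 1, p + Polynomial.C 2, D, fun n => ⟨(hD n).1, (hD n).2.1, (hD n).2.2.1⟩, fun x => ?_⟩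
  have := (hD x.length).2.2.2 x.get
  rwa [List.ofFn_get] at this

/-- **Support item `LiouvilleNotAC0` of route Mobius (stmt-PneNP-1112)**: `bin {N : λ(N) = 1} ∉ AC⁰` — Green's theorem,
transferred along the sign from the kernel-checked `{λ = -1}` version of the QuantumAdvantage MobiusLadder files
(`LiouvilleNotAC0_proof`, `LiouvilleOrthogonalAC0_proof`). [cite: Green2012, Thm. 1] [cite: AroraBarak2009, §14.1] -/
theorem mobius_liouvilleNotAC0_proof : Summit.PneNP.PneNP.Theses.Mobius.LiouvilleNotAC0 := fun h =>
  Summit.QuantumAdvantage.QuantumAdvantage.Theorems.MobiusLadder.LiouvilleNotAC0_proof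
    Summit.QuantumAdvantage.QuantumAdvantage.Theorems.LiouvilleOrthogonalAC0_proof
    (mobius_liouvilleNeg_mem_AC0_of_pos h)

end Summit.PneNP.PneNP.Theorems
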